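import Summits.QuantumFields.Balaban3D.Proofs.Newborn46
import Summits.QuantumFields.Balaban3D.Proofs.Bound46Series
import Summits.QuantumFields.Balaban3D.Proofs.StandardAC

/-!
# Bałaban CMP 102 (1985), d = 3 lane — `Proofs.Bound46AC`: **THE INTERACTION BOUND (46) p.267 FOR THE AC TOWER** («Σ_{j=1}^k Σ_{Y_j}|𝒫_j(Y_j, U_k)| ≤
# O(1)M₁³g²_{k−1}p²(g_{k−1})|Λ_k|»): seat p2's `Bound46Series` (old slice from (44)) and seat p6's `Newborn46` (newborn slice from G3D-01/(28)/G3D-06/`hPY`,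
# G3D-07/`hPYZ`, G3D-08) re-read for the AC series tower `SeriesAC.TowerBaseAC.withSeriesAC` (averaging merely absolutely continuous, uncapped masses) —
# lane `pub-balaban3d`, seat alpha-1 (g3; STUB 2″ clause (c) `PintSize` of crux `HistoryTailL` at the v3 datum reads this through `AlphaInputsT3ACv3Pint`)

WHY A RE-READING IS CHEAP.  The interaction sum of a series tower is `pintOfSeries M₁ Rcol 𝔖` — a function of the expansion data and the TWO region parameters
only (R-FL (ii)); the Haar-side lemmas (`Bound46Series.abs_poldIn_le`, `Run3Newborn.newbornY46_series`, `card_ΩblkOf_le_real`, `cubes_subset_of_mem_loc`)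
read their `B : Carriers.TowerBase` through the parameters `M₁, Rcol, Rret, b₀, p₀` alone.  §1 gives the bookkeeping device `TowerBaseAC.toBase1` (the AC base
with its uncapped masses REPLACED by constant-one weights — never used as a tower, only as a parameter carrier) so those lemmas apply verbatim; §2 is R-46N's
`newborn46_series` at the AC series' pieces (the binders G3D-07/G3D-08 typed at the AC tower, as `AlphaAC.AlphaDataAC` carries them); §3 is (46) one step up for
`pintOfSeries` in the threshold form; §4 reads it at the standard AC input `stdTowerInputAC X K 𝔖` for every `1 ≤ k ≤ K`, volume `#Ω_k^{(k)}(h)`.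
HONEST FRAMING: bookkeeping over cited binders; nothing of [Balaban1985UV3] is asserted.
-/

noncomputable section

namespace Summit.QuantumFields.Balaban3D.Proofs.Bound46AC

open MeasureTheory Finset
open scoped BigOperators
open Literature.MathematicalPhysics.QuantumFieldTheory.Balaban1983to89
open Literature.MathematicalPhysics.QuantumFieldTheory.Balaban1983to89.B10
open Literature.MathematicalPhysics.QuantumFieldTheory.Balaban1983to89.B10SectCExpansion (Bound44)
open Literature.MathematicalPhysics.QuantumFieldTheory.Balaban1983to89.B12TreeDecay (kappa₀ K₀ K₀_pos)
open Literature.MathematicalPhysics.QuantumFieldTheory.Balaban1983to89.TreeLengthTorus (tsys tcubeSys)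
open Literature.MathematicalPhysics.QuantumFieldTheory.Balaban1985CMP102
open Literature.MathematicalPhysics.QuantumFieldTheory.Balaban1985CMP102.Setting
open Literature.MathematicalPhysics.QuantumFieldTheory.Balaban1985CMP102.Binders
  (ChartAnalyticityAsCited FarTermsDecayAsCited LogZLocalizedAsCited)
open Literature.MathematicalPhysics.QuantumFieldTheory.Balaban1985CMP102.BindersNewborn (NewbornTerms45AsCited)
open Summit.QuantumFields.Balaban3D.Carriers
open Summit.QuantumFields.Balaban3D.Proofs.Representation33 (jet26 ChartConsts)
open Summit.QuantumFields.Balaban3D.Proofs.NewbornJet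
open Summit.QuantumFields.Balaban3D.Proofs.NewbornCount
open Summit.QuantumFields.Balaban3D.Proofs.Run3Newborn
open Summit.QuantumFields.Balaban3D.Proofs.Newborn46 (Cnew46 Cnew46_nonneg newborn46_series)
open Summit.QuantumFields.Balaban3D.Proofs.Bound46Series (abs_poldIn_le)
open Summit.QuantumFields.Balaban3D.Proofs.ScalesArithmetic
open Summit.QuantumFields.Balaban3D.Proofs.Thresholds (gammaOf gammaOf_spec)
open Summit.QuantumFields.Balaban3D.Proofs.TowerAC
open Summit.QuantumFields.Balaban3D.Proofs.SeriesAC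
open Summit.QuantumFields.Balaban3D.Proofs.StandardAC

variable {L : ℕ} {S : Scales L} {G : Type} [GaugeGroup G] [MeasurableSpace G] [HaarData G]

/-! ## §1 The parameter carrier -/

/-- Constant-one history weights (a bookkeeping device: `m_k(h, U) := 1`). [folklore] -/
def onesWeights : HistWeights S.P G where
  mass := fun _ _ _ => 1
  mass_nonneg := fun _ _ _ => zero_le_one
  mass_le_one := fun _ _ _ => le_rfl
  mass_zero := fun _ _ => rfl

/-- **THE AC BASE AS A PARAMETER CARRIER**: `Carriers.TowerBase` with the SAME `ε₁, av, reg, Uk, M₁, Rcol, Rret, b₀, p₀, κ₀, UkH, zcoef, rcoef` and constant-one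
weights in place of the uncapped masses.  Used ONLY to feed lemmas that read the parameters (never as a tower). [folklore] -/
def toBase1 (B : TowerBaseAC S G) : TowerBase S G where
  ε₁ := B.ε₁
  av := B.av
  avgAC := B.avgAC
  reg := B.reg
  Uk := B.Uk
  M₁ := B.M₁
  Rcol := B.Rcol
  Rret := B.Rret
  b₀ := B.b₀
  p₀ := B.p₀
  κ₀ := B.κ₀
  W := onesWeights
  UkH := B.UkH
  UkH_triv := B.UkH_triv
  zcoef := B.zcoef
  rcoef := B.rcoef

/-! ## §2 The newborn slice of (46) at the AC series' pieces (R-46N re-read) -/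

section Series

variable {V : Type} [NormedAddCommGroup V] [NormedSpace ℂ V] [FiniteDimensional ℂ V] {Nc : ℕ → ℕ} [∀ k, NeZero (Nc k)]
  (B : TowerBaseAC S G) (𝔖 : ∀ k, StepSeries S G V (Nc k) k) (C : ∀ k, PiecesParams S k) (k : ℕ)

/-- **R-46N AT THE AC SERIES' PIECES**: `Newborn46.newborn46_series` with the GAP binders G3D-07 (`Λc`) and G3D-08 (`N45`) typed at the AC series tower
`(B.withSeriesAC 𝔖 C).tower3` and its pieces `B.seriesPiecesAC 𝔖 C k` (as `AlphaAC.AlphaDataAC` carries them): from G3D-01 at the (25)-rate, (28) in the window,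
G3D-06, `hPY`, G3D-07 + `hPYZ`, G3D-08, for every history and field `|PY_k h U + PYZ_k h U| ≤ Cnew46·(g_kp(g_k))²·#Ω_{k+1}^{(k+1)}(h)`.  Proof = the Haar one
(perturbative part `Run3Newborn.newbornY46_series`, (61)-born part G3D-08 + `NewbornJet.sum_le_of_inside` + the block count), the parameter-only helpers fed
through `toBase1`. [cite: Balaban1985UV3, (46) p.267 + (33)–(34) p.264 + (61) p.271] -/
theorem newborn46_seriesAC (hk : k ≤ S.K) (hk1 : k + 1 ≤ S.P.m + S.P.K) (κc : ChartConsts) {κ C25 C63 C45 : ℝ}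
    (hκ : kappa₀ (4 * 2 ^ 3) (2 * 3) ≤ κ) (hC25 : 0 ≤ C25) (hC63 : 0 ≤ C63) (hb₀ : 0 ≤ B.b₀) (hp₀ : 0 < B.p₀)
    (hr₀ : 0 < κc.r₀) (hN : Nc k = max 1 (S.P.sitesPerDir k / B.M₁))
    (chart : ∀ X, ChartAnalyticityAsCited ((𝔖 k).Ψ X) κc.ρ
      (C25 * S.gk k * Real.exp (-(κ * (tsys 3 (Nc k)).dj X))))
    (bound28 : ∀ X h U, ‖(𝔖 k).Bcfg X h U‖ ≤ κc.cB * (rFun κc.r₀ (S.gk k) * S.gk k * pFun B.b₀ B.p₀ (S.gk k)))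
    (small28 : κc.cB * (rFun κc.r₀ (S.gk k) * S.gk k * pFun B.b₀ B.p₀ (S.gk k)) ≤ κc.ρ / 4)
    (far_le : FarTermsDecayAsCited (𝔖 k).far (fun X => C25 * S.gk k * Real.exp (-(κ * (tsys 3 (Nc k)).dj X)))
      κc.Cfar (S.gk k ^ 7 * (rFun κc.r₀ (S.gk k) * pFun B.b₀ B.p₀ (S.gk k)) ^ 7))
    (hPY : ∀ h U, (𝔖 k).PY h U
      = ∑ X ∈ (𝔖 k).loc (ΩblkOf B.M₁ B.Rcol (Nc k)) (B.Rret k) h,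
          ((jet26 ((𝔖 k).Ψ X) ((𝔖 k).Bcfg X h U)).re - (𝔖 k).far X h U))
    {Γ : Type} {π : Γ → (𝔖 k).E →L[ℂ] (𝔖 k).E}
    (Λc : LogZLocalizedAsCited (B.withSeriesAC 𝔖 C).tower3.toTowerRun k (𝔖 k).E π κc.ρ κc.r₀ κc.Cfar C63 κ
      (B.seriesPiecesAC 𝔖 C k).logZU (B.seriesPiecesAC 𝔖 C k).logZ1 (𝔖 k).Bcfg
      (fun h => Finset.univ.filter fun X : (tsys 3 (Nc k)).Dom => X.1 ⊆ ΩblkOf B.M₁ B.Rcol (Nc k) h))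
    (N45 : NewbornTerms45AsCited (B.withSeriesAC 𝔖 C).tower3.toTowerRun k (𝔖 k).E π κc.ρ κc.r₀ κc.Cfar C63 κ
      (B.seriesPiecesAC 𝔖 C k).logZU (B.seriesPiecesAC 𝔖 C k).logZ1 (𝔖 k).Bcfg
      (fun h => Finset.univ.filter fun X : (tsys 3 (Nc k)).Dom => X.1 ⊆ ΩblkOf B.M₁ B.Rcol (Nc k) h) Λc C45)
    (hPYZ : ∀ h U, (𝔖 k).PYZ h U
      = ∑ X ∈ (𝔖 k).loc (ΩblkOf B.M₁ B.Rcol (Nc k)) (B.Rret k) h,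
          ((jet26 (Λc.Ψ X) ((𝔖 k).Bcfg X h U)).re - Λc.far X h U)) :
    ∀ (h : Hist S.P (k + 1)) (U : GaugeField S.P (k + 1) G),
      |(𝔖 k).PY h U + (𝔖 k).PYZ h U|
        ≤ Cnew46 L κc C25 C63 C45 B.b₀ B.p₀ * (S.gk k * B10.pFun B.b₀ B.p₀ (S.gk k)) ^ 2
            * (LamFin B.M₁ B.Rcol k h).card := by
  intro h U
  have hK := K₀_pos (4 * 2 ^ 3) (2 * 3)
  have hY := newbornY46_series (toBase1 B) 𝔖 k hk hk1 κc hκ hC25 hb₀ hp₀ hr₀ hN chart bound28 small28 far_le hPY h U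
  have hcount := card_ΩblkOf_le_real (toBase1 B) k hk1 hN h
  dsimp only [toBase1] at hY hcount
  have hsumM : ∑ X ∈ (𝔖 k).loc (ΩblkOf B.M₁ B.Rcol (Nc k)) (B.Rret k) h,
        C63 * Real.exp (-(κ * (tsys 3 (Nc k)).dj X))
      ≤ C63 * K₀ (4 * 2 ^ 3) (2 * 3) * ((ΩblkOf B.M₁ B.Rcol (Nc k) h).card : ℝ) :=
    sum_le_of_inside (tcubeSys 3 (Nc k)) (TreeLengthTorus.tdegreeLE 3 _) (TreeLengthTorus.tvolumeLeaf 3 _) hκ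
      hC63 (fun X => C63 * Real.exp (-(κ * (tsys 3 (Nc k)).dj X)))
      (fun X => mul_nonneg hC63 (Real.exp_nonneg _)) (fun X => le_rfl) (ΩblkOf B.M₁ B.Rcol (Nc k) h)
      ((𝔖 k).loc (ΩblkOf B.M₁ B.Rcol (Nc k)) (B.Rret k) h) (cubes_subset_of_mem_loc (toBase1 B) 𝔖 k h)
  have hgp : 0 ≤ C45 * (S.gk k * pFun B.b₀ B.p₀ (S.gk k)) ^ 2 := mul_nonneg N45.C45_nonneg (sq_nonneg _)
  have hZ : |(𝔖 k).PYZ h U|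
      ≤ C45 * (S.gk k * pFun B.b₀ B.p₀ (S.gk k)) ^ 2
          * (C63 * K₀ (4 * 2 ^ 3) (2 * 3) * ((L : ℝ) ^ 3 * ((LamFin B.M₁ B.Rcol k h).card : ℝ))) := by
    rw [hPYZ h U]
    refine (N45.abs_sum_le _ h U).trans (mul_le_mul_of_nonneg_left (hsumM.trans ?_) hgp)
    exact mul_le_mul_of_nonneg_left hcount (mul_nonneg hC63 hK.le)
  calc |(𝔖 k).PY h U + (𝔖 k).PYZ h U| ≤ |(𝔖 k).PY h U| + |(𝔖 k).PYZ h U| := abs_add_le _ _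
    _ ≤ _ := add_le_add hY hZ
    _ = _ := by unfold Cnew46; ring

/-! ## §3 (46) one step up for the AC series tower, threshold form -/

omit [FiniteDimensional ℂ V] in
/-- **(46) FOR THE AC SERIES TOWER AT SCALE `k+1`, THRESHOLD FORM**: `Pint (k+1) = PoldIn_k + PY_k + PYZ_k` (`withSeriesAC_Pint_succ`); the old slice by
`Bound46Series.abs_poldIn_le` (display (44) `h44`, floor `hfloor`, smallness from `g_k ≤ γ₄₆`), the newborn slice the named input `hnew`; volume
`#LamFin M₁ Rcol k h = |Ω_{k+1}^{(k+1)}(h)|`. [cite: Balaban1985UV3, (44)–(46) p.267 + (33)–(34) p.264] -/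
theorem abs_pint_succ_le_gammaAC (hk : k + 1 ≤ S.m + S.K) {κ₁ B₃ C₀ Cnew : ℝ} (hC : 0 ≤ C₀) (hB : 0 ≤ B₃) (hκ₁ : 0 < κ₁)
    (hM : 0 < B.M₁) (hb₀ : 0 < B.b₀) (hp₀ : 0 < B.p₀) (hg : 0 < S.gk k) (hg1 : S.gk k ≤ 1)
    (h44 : ∀ (h : Hist S.P (k + 1)) (U : GaugeField S.P (k + 1) G), ∀ j ∈ Icc 1 k,
      Bound44 (oldGeom S.P k j) (fun y n c => (𝔖 k).oldVal h U j y n c) κ₁ (B.M₁ : ℝ) (ell S.P k j) (L : ℝ) B₃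
        (S.gk k) (B10.pFun B.b₀ B.p₀ (S.gk k)) C₀)
    (hfloor : ∀ (h : Hist S.P (k + 1)) (U : GaugeField S.P (k + 1) G), ∀ j ∈ Icc 1 k, ∀ (y : Site S.P j) (n : ℕ)
      (c : Fin n → PBond S.P j), (𝔖 k).oldVal h U j y n c ≠ 0 → 2 ≤ n)
    (hγ : S.gk k ≤ gammaOf B.b₀ B.p₀ (1 / (2 * (8 * (L : ℝ) ^ 2 * B₃ *
        (2 / (κ₁ / B.M₁) * (24 * (48 / (κ₁ / B.M₁ / 2) ^ 3 * Real.exp (κ₁ / B.M₁ / 2 / 2) /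
          (1 - Real.exp (-(κ₁ / B.M₁ / 2 / 2)))) * 1))))))
    (hnew : ∀ (h : Hist S.P (k + 1)) (U : GaugeField S.P (k + 1) G),
      |(𝔖 k).PY h U + (𝔖 k).PYZ h U| ≤ Cnew * (S.gk k * B10.pFun B.b₀ B.p₀ (S.gk k)) ^ 2 * (LamFin B.M₁ B.Rcol k h).card)
    (h : Hist S.P (k + 1)) (U : GaugeField S.P (k + 1) G) :
    |(B.withSeriesAC 𝔖 C).tower3.toTowerRun.Pint (k + 1) h U| ≤
      (2 * C₀ * (8 * (L : ℝ) ^ 2 * B₃ *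
          (2 / (κ₁ / B.M₁) * (24 * (48 / (κ₁ / B.M₁ / 2) ^ 3 * Real.exp (κ₁ / B.M₁ / 2 / 2) /
            (1 - Real.exp (-(κ₁ / B.M₁ / 2 / 2)))) * 1))) ^ 2 * ((L : ℝ) ^ 4 / ((L : ℝ) - 1)) + Cnew) *
        (S.gk k * B10.pFun B.b₀ B.p₀ (S.gk k)) ^ 2 * (LamFin B.M₁ B.Rcol k h).card := by
  set X : ℝ := 8 * (L : ℝ) ^ 2 * B₃ *
    (2 / (κ₁ / B.M₁) * (24 * (48 / (κ₁ / B.M₁ / 2) ^ 3 * Real.exp (κ₁ / B.M₁ / 2 / 2) /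
      (1 - Real.exp (-(κ₁ / B.M₁ / 2 / 2)))) * 1)) with hXdef
  have hM' : (0 : ℝ) < B.M₁ := by exact_mod_cast hM
  have hX0 : 0 ≤ X := by
    rw [hXdef]
    have ha : 0 < κ₁ / (B.M₁ : ℝ) := by positivity
    have h1 : Real.exp (-(κ₁ / B.M₁ / 2 / 2)) < 1 := Real.exp_lt_one_iff.2 (by linarith)
    have h2 : 0 < 1 - Real.exp (-(κ₁ / B.M₁ / 2 / 2)) := by linarith
    positivity
  have hsmall : X * S.gk k * B10.pFun B.b₀ B.p₀ (S.gk k) ≤ 1 / 2 := by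
    rcases hX0.eq_or_lt with hX | hX
    · rw [← hX]; norm_num
    · have hσ : 0 ≤ 1 / (2 * X) := by positivity
      have hgp := gammaOf_spec hb₀ hp₀ hσ hg hγ
      calc X * S.gk k * B10.pFun B.b₀ B.p₀ (S.gk k) = X * (S.gk k * B10.pFun B.b₀ B.p₀ (S.gk k)) := by ring
        _ ≤ X * (1 / (2 * X)) := mul_le_mul_of_nonneg_left hgp hX.le
        _ = 1 / 2 := by field_simp
  have hold := abs_poldIn_le (toBase1 B) 𝔖 k hk hC hB hκ₁ hM hb₀.le hg hg1 h44 hfloor hsmall h U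
  dsimp only [toBase1] at hold
  have hn := hnew h U
  have hsplit : (B.withSeriesAC 𝔖 C).tower3.toTowerRun.Pint (k + 1) h U =
      (𝔖 k).PoldIn B.M₁ B.Rcol h U + ((𝔖 k).PY h U + (𝔖 k).PYZ h U) := by
    show (B.withSeriesAC 𝔖 C).Pint (k + 1) h U = _
    rw [TowerBaseAC.withSeriesAC_Pint_succ, add_assoc]
  rw [hsplit]
  refine (abs_add_le _ _).trans ?_
  rw [add_mul, add_mul]
  exact add_le_add hold hn

end Series

/-! ## §4 (46) at the standard AC input, every `1 ≤ k ≤ K` -/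

section Std

variable {V : Type} [NormedAddCommGroup V] [NormedSpace ℂ V] [FiniteDimensional ℂ V]
  (X : ExternalInputsAC S G) (K : CarrierConsts) (𝔖 : ∀ k, StepSeries S G V (nblkOf S K k) k)

/-- **(46) FOR THE STANDARD AC TOWER INPUT, ONE STEP UP, every `k < K`** (LEAF-LEDGER B15 at `stdTowerInputAC X K 𝔖`; «Σ_{j=1}^k Σ_{Y_j}|𝒫_j(Y_j, U_k)| ≤
O(1)M₁³g²_{k−1}p²(g_{k−1})|Λ_k|» at `k + 1`, `|Λ_{k+1}|` read as `#Ω_{k+1}^{(k+1)}(h) = #LamFin k h`): per step the old slice from the display (44) (`h44`, `hfloor`, threshold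
`hγ46`) and the newborn slice from the C5/C7 inputs and G3D-08 (`newborn46_seriesAC`); constant
`A46 = 2C(8L²B₃Z′(κ₁/M₁))²L⁴/(L−1) + Cnew46`. [cite: Balaban1985UV3, (44)–(46) p.267 + (33)–(34) p.264 + (61) p.271] -/
theorem abs_pint_le_stdAC {κ₁ B₃ C₀ : ℝ} (hC : 0 ≤ C₀) (hB : 0 ≤ B₃) (hκ₁ : 0 < κ₁) (hM : 0 < K.M₁) (hb₀ : 0 < K.b₀) (hp₀ : 0 < K.p₀)
    (κc : ChartConsts) {κ C25 C63 C45 : ℝ}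
    (hκ : kappa₀ (4 * 2 ^ 3) (2 * 3) ≤ κ) (hC25 : 0 ≤ C25) (hC63 : 0 ≤ C63) (hr₀ : 0 < κc.r₀)
    (h44 : ∀ k, k + 1 ≤ S.K → ∀ (h : Hist S.P (k + 1)) (U : GaugeField S.P (k + 1) G), ∀ j ∈ Icc 1 k,
      Bound44 (oldGeom S.P k j) (fun y n c => (𝔖 k).oldVal h U j y n c) κ₁ (K.M₁ : ℝ) (ell S.P k j) (L : ℝ) B₃
        (S.gk k) (B10.pFun K.b₀ K.p₀ (S.gk k)) C₀)
    (hfloor : ∀ k, k + 1 ≤ S.K → ∀ (h : Hist S.P (k + 1)) (U : GaugeField S.P (k + 1) G), ∀ j ∈ Icc 1 k,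
      ∀ (y : Site S.P j) (n : ℕ) (c : Fin n → PBond S.P j), (𝔖 k).oldVal h U j y n c ≠ 0 → 2 ≤ n)
    (hγ46 : ∀ k, k + 1 ≤ S.K → S.gk k ≤ gammaOf K.b₀ K.p₀ (1 / (2 * (8 * (L : ℝ) ^ 2 * B₃ *
        (2 / (κ₁ / K.M₁) * (24 * (48 / (κ₁ / K.M₁ / 2) ^ 3 * Real.exp (κ₁ / K.M₁ / 2 / 2) /
          (1 - Real.exp (-(κ₁ / K.M₁ / 2 / 2)))) * 1))))))
    (chart : ∀ k, k + 1 ≤ S.K → ∀ Y, ChartAnalyticityAsCited ((𝔖 k).Ψ Y) κc.ρ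
      (C25 * S.gk k * Real.exp (-(κ * (tsys 3 (nblkOf S K k)).dj Y))))
    (bound28 : ∀ k, k + 1 ≤ S.K → ∀ Y h U, ‖(𝔖 k).Bcfg Y h U‖ ≤ κc.cB * (rFun κc.r₀ (S.gk k) * S.gk k * pFun K.b₀ K.p₀ (S.gk k)))
    (small28 : ∀ k, k + 1 ≤ S.K → κc.cB * (rFun κc.r₀ (S.gk k) * S.gk k * pFun K.b₀ K.p₀ (S.gk k)) ≤ κc.ρ / 4)
    (far_le : ∀ k, k + 1 ≤ S.K → FarTermsDecayAsCited (𝔖 k).far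
      (fun Y => C25 * S.gk k * Real.exp (-(κ * (tsys 3 (nblkOf S K k)).dj Y)))
      κc.Cfar (S.gk k ^ 7 * (rFun κc.r₀ (S.gk k) * pFun K.b₀ K.p₀ (S.gk k)) ^ 7))
    (hPY : ∀ k, k + 1 ≤ S.K → ∀ h U, (𝔖 k).PY h U
      = ∑ Y ∈ (𝔖 k).loc (ΩblkOf K.M₁ (rcolOf S K) (nblkOf S K k)) (rretOf S K k) h,
          ((jet26 ((𝔖 k).Ψ Y) ((𝔖 k).Bcfg Y h U)).re - (𝔖 k).far Y h U))
    {Γ : ℕ → Type} {π : ∀ k, Γ k → (𝔖 k).E →L[ℂ] (𝔖 k).E}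
    (Λc : ∀ k, k + 1 ≤ S.K → LogZLocalizedAsCited (stdTowerInputAC X K 𝔖).tower3.toTowerRun k (𝔖 k).E (π k) κc.ρ κc.r₀ κc.Cfar C63 κ
      ((X.toTowerBase K).seriesPiecesAC 𝔖 (piecesParamsOf S K) k).logZU
      ((X.toTowerBase K).seriesPiecesAC 𝔖 (piecesParamsOf S K) k).logZ1 (𝔖 k).Bcfg
      (fun h => Finset.univ.filter fun Y : (tsys 3 (nblkOf S K k)).Dom => Y.1 ⊆ ΩblkOf K.M₁ (rcolOf S K) (nblkOf S K k) h))
    (N45 : ∀ k (hk : k + 1 ≤ S.K), NewbornTerms45AsCited (stdTowerInputAC X K 𝔖).tower3.toTowerRun k (𝔖 k).E (π k) κc.ρ κc.r₀ κc.Cfar C63 κ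
      ((X.toTowerBase K).seriesPiecesAC 𝔖 (piecesParamsOf S K) k).logZU
      ((X.toTowerBase K).seriesPiecesAC 𝔖 (piecesParamsOf S K) k).logZ1 (𝔖 k).Bcfg
      (fun h => Finset.univ.filter fun Y : (tsys 3 (nblkOf S K k)).Dom => Y.1 ⊆ ΩblkOf K.M₁ (rcolOf S K) (nblkOf S K k) h) (Λc k hk) C45)
    (hPYZ : ∀ k (hk : k + 1 ≤ S.K), ∀ h U, (𝔖 k).PYZ h U
      = ∑ Y ∈ (𝔖 k).loc (ΩblkOf K.M₁ (rcolOf S K) (nblkOf S K k)) (rretOf S K k) h,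
          ((jet26 ((Λc k hk).Ψ Y) ((𝔖 k).Bcfg Y h U)).re - (Λc k hk).far Y h U)) :
    ∀ k, k + 1 ≤ S.K → ∀ (h : Hist S.P (k + 1)) (U : GaugeField S.P (k + 1) G),
      |(stdTowerInputAC X K 𝔖).Pint (k + 1) h U| ≤
        (2 * C₀ * (8 * (L : ℝ) ^ 2 * B₃ *
            (2 / (κ₁ / K.M₁) * (24 * (48 / (κ₁ / K.M₁ / 2) ^ 3 * Real.exp (κ₁ / K.M₁ / 2 / 2) /
              (1 - Real.exp (-(κ₁ / K.M₁ / 2 / 2)))) * 1))) ^ 2 * ((L : ℝ) ^ 4 / ((L : ℝ) - 1)) +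
            Cnew46 L κc C25 C63 C45 K.b₀ K.p₀) *
          (S.gk k * B10.pFun K.b₀ K.p₀ (S.gk k)) ^ 2 * (LamFin K.M₁ (rcolOf S K) k h).card := by
  intro k hkK h U
  have hnew := newborn46_seriesAC (X.toTowerBase K) 𝔖 (piecesParamsOf S K) k (by omega) (by show k + 1 ≤ S.m + S.K; omega) κc hκ hC25
    hC63 hb₀.le hp₀ hr₀ rfl (chart k hkK) (bound28 k hkK) (small28 k hkK) (far_le k hkK) (hPY k hkK) (Λc k hkK)
    (N45 k hkK) (hPYZ k hkK)
  exact abs_pint_succ_le_gammaAC (X.toTowerBase K) 𝔖 (piecesParamsOf S K) k (by show k + 1 ≤ S.m + S.K; omega) hC hB hκ₁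
    hM hb₀ hp₀ (gk_pos S k) (gk_le_one S S.gK_le_one k (by omega)) (h44 k hkK) (hfloor k hkK) (hγ46 k hkK) hnew h U

end Std

end Summit.QuantumFields.Balaban3D.Proofs.Bound46AC

end
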